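import Summits.KontsevichZagierPeriods.KontsevichZagierPeriods.Theorems.LinRedNormalFormArrangementNormalFormSeparateAllHHSecMain
import Summits.KontsevichZagierPeriods.KontsevichZagierPeriods.Theorems.LinRedNormalFormArrangementNormalFormSeparateAllHHCover

/-!
# Local finiteness of the density of the Taylor pieces at every base point, any base dimension

(Line `janus-bands`, crux `ArrangementNormalForm`, stub `stub_separateHigh_hH`, part `AllHHLocal` of
the dimension-generic wall-invariant termwise-split lemma, base dimension `b + 1 ≥ 4` with fibres;
namespace `SepAll`.)
Every point `z₁` of the closure of the effective base polyhedron `Y ⊆ ℝ^{b+1}` has an open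
neighbourhood on which the density `g = 𝟙_Y (∑_{i<N} |Ri i|) · m` of the Taylor pieces against the
fibre mass has finite integral (`local_finite`, registered as `separateAllHH_local`). Proof: the
sector theorem `SepAll.sector_finite` (part `AllHHSecMain`) assigns a positive scale to every
independent frame containing a vertical vector; the cover `SepAll.full_cover` (part `AllHHCover`)
with the distinguished vertical coordinate produces finitely many such frames whose half-open
nested sectors within the assigned scales cover a punctured ball around `z₁`; a half-open sector
is the open one plus the image of a Lebesgue-null set under the polynomial chart (null), and the
centre is a point (null).
-/

noncomputable section

open Set Finset MeasureTheory Filter Topology Function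
open scoped ENNReal

namespace Summit.KontsevichZagierPeriods.ArrangementNormalForm.JanusBands

namespace SepAll

open SepTwo MvPolynomial

variable {k b mL m'' : ℕ}

/-! ### Null boundaries -/

/-- The difference of the half-open and the open box is Lebesgue-null. -/
theorem volume_hbox_diff_box (δ : Fin (b + 1) → ℝ) : volume (hbox δ \ box δ) = 0 := by
  have hsub : hbox δ \ box δ ⊆ ⋃ l', {w : Fin (b + 1) → ℝ | w l' = 0} := by
    rintro w ⟨hh, hb⟩
    simp only [mem_iUnion, mem_setOf_eq]
    by_contra hall
    push Not at hall
    exact hb (mem_box.2 fun l' => ⟨lt_of_le_of_ne (hh l').2.1 (Ne.symm (hall l')), (hh l').2.2⟩)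
  refine measure_mono_null hsub (measure_iUnion_null fun l' => ?_)
  rw [volume_pi]
  exact Measure.pi_hyperplane _ l' 0

/-- Its image under the chart is Lebesgue-null. -/
theorem volume_image_hbox_diff (z₁ : Fin (b + 1) → ℝ) (f : Fin (b + 1) → Fin (b + 1) → ℝ)
    (δ : Fin (b + 1) → ℝ) : volume ((fun w => z₁ + npt f w) '' (hbox δ \ box δ)) = 0 :=
  addHaar_image_eq_zero_of_differentiableOn_of_addHaar_eq_zero volume
    (fun w _ => (hasFDerivAt_npt z₁ f w).differentiableAt.differentiableWithinAt)
    (volume_hbox_diff_box δ)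

/-! ### Local finiteness -/

/-- **Local finiteness of the density of the Taylor pieces at every base point.** See the module
docstring. -/
theorem local_finite (φ : Fin m'' → (Fin (b + 1) → ℝ) × ℝ)
    (lo hi : Fin k → Fin k ⊕ Atm (b + 1)) (a : Fin k → Option (Atm (b + 1)))
    (κ : Fin mL → Fin b → ℝ) (μ : Fin mL → ℝ) (e : Fin mL → ℕ) (n : ℕ) (l : Fin b → ℝ) (l₀ : ℝ)
    (N : ℕ) (q : ℕ → MvPolynomial (Fin b) ℝ)
    (R : (Fin (b + 1) → ℝ) → ℝ) (Ri : ℕ → (Fin (b + 1) → ℝ) → ℝ)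
    (hR : ∀ x, R x = (∑ i ∈ range N, eval (pr x) (q i) * lam l l₀ x ^ i) / common κ μ e n l l₀ x)
    (hRi : ∀ i, i < N → ∀ x, Ri i x = eval (pr x) (q i) * lam l l₀ x ^ i / common κ μ e n l l₀ x)
    (hfinY : ∫⁻ x in {x | ∀ j, 0 < rav x (φ j)}, ENNReal.ofReal |R x| * lmass lo hi a (av x) < ∞)
    (hκ0 : ∀ j, e j ≠ 0 → κ j = 0 → μ j ≠ 0)
    (hH' : ∀ j, e j ≠ 0 → ∀ x ∈ closure {x | ∀ j, 0 < rav x (φ j)}, lval κ μ j x = 0 →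
      n ≠ 0 ∧ lam l l₀ x = 0)
    (hnz : ∃ x₀, (∑ i ∈ range N, eval (pr x₀) (q i) * lam l l₀ x₀ ^ i) ≠ 0)
    (z₁ : Fin (b + 1) → ℝ) (hz₁ : z₁ ∈ closure {x | ∀ j, 0 < rav x (φ j)}) :
    ∃ V : Set (Fin (b + 1) → ℝ), IsOpen V ∧ z₁ ∈ V ∧
      ∫⁻ x in V, {x | ∀ j, 0 < rav x (φ j)}.indicator
        (fun x => (∑ i ∈ range N, ENNReal.ofReal |Ri i x|) * lmass lo hi a (av x)) x < ∞ := by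
  classical
  set g : (Fin (b + 1) → ℝ) → ℝ≥0∞ := {x | ∀ j, 0 < rav x (φ j)}.indicator
    fun x => (∑ i ∈ range N, ENNReal.ofReal |Ri i x|) * lmass lo hi a (av x) with hg
  -- admissible frames and their scales
  set P : (Fin (b + 1) → Fin (b + 1) → ℝ) → Prop := fun f =>
    LinearIndependent ℝ f ∧ ∃ l₀', ∀ k', f l₀' (Fin.castSucc k') = 0 with hP
  have hsec : ∀ f, P f → ∃ δmax : ℝ, 0 < δmax ∧ ∀ δ : Fin (b + 1) → ℝ,
      (∀ l', 0 < δ l' ∧ δ l' ≤ δmax) → ∫⁻ x in nsec z₁ f δ, g x < ∞ := by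
    intro f hf
    obtain ⟨l₀', hv⟩ := hf.2
    exact sector_finite φ lo hi a κ μ e n l l₀ N q R Ri hR hRi hfinY hκ0 hH' hnz z₁ hz₁ f hf.1 l₀' hv
  set Sc : (Fin (b + 1) → Fin (b + 1) → ℝ) → Fin (b + 1) → ℝ := fun f _ =>
    if h : P f then Classical.choose (hsec f h) else 1 with hSc
  have hScpos : ∀ f l', 0 < Sc f l' := by
    intro f l'
    simp only [hSc]
    split_ifs with h
    · exact (Classical.choose_spec (hsec f h)).1
    · exact one_pos
  obtain ⟨ι, hι, _, F, Δ, hli, hE, hΔ, ρ, hρ, hcov⟩ := full_cover (b + 1) (some (Fin.last b)) Sc hScpos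
  -- every frame of the cover is admissible and its sector has finite mass
  have hPF : ∀ mm, P (F mm) := by
    intro mm
    refine ⟨hli mm, ?_⟩
    obtain ⟨l₀', c, -, hl⟩ := hE (Fin.last b) rfl mm
    exact ⟨l₀', fun k' => by
      rw [hl, Pi.smul_apply, Pi.single_eq_of_ne (Fin.castSucc_lt_last k').ne, smul_zero]⟩
  have hfinm : ∀ mm, ∫⁻ x in nsec z₁ (F mm) (Δ mm), g x < ∞ := by
    intro mm
    have hs := Classical.choose_spec (hsec (F mm) (hPF mm))
    refine hs.2 (Δ mm) fun l' => ⟨(hΔ mm l').1, ?_⟩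
    have := (hΔ mm l').2
    simp only [hSc, dif_pos (hPF mm)] at this
    exact this
  -- the half-open sectors
  set Hs : ι → Set (Fin (b + 1) → ℝ) := fun mm => (fun w => z₁ + npt (F mm) w) '' hbox (Δ mm) with hHs
  have hfinH : ∀ mm, ∫⁻ x in Hs mm, g x < ∞ := by
    intro mm
    have hsplit : Hs mm ⊆ nsec z₁ (F mm) (Δ mm) ∪
        (fun w => z₁ + npt (F mm) w) '' (hbox (Δ mm) \ box (Δ mm)) := by
      rintro _ ⟨w, hw, rfl⟩
      by_cases hbx : w ∈ box (Δ mm)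
      · exact Or.inl ⟨w, hbx, rfl⟩
      · exact Or.inr ⟨w, ⟨hw, hbx⟩, rfl⟩
    calc ∫⁻ x in Hs mm, g x
        ≤ ∫⁻ x in nsec z₁ (F mm) (Δ mm) ∪ (fun w => z₁ + npt (F mm) w) '' (hbox (Δ mm) \ box (Δ mm)), g x :=
          lintegral_mono_set hsplit
      _ ≤ (∫⁻ x in nsec z₁ (F mm) (Δ mm), g x) +
            ∫⁻ x in (fun w => z₁ + npt (F mm) w) '' (hbox (Δ mm) \ box (Δ mm)), g x :=
          lintegral_union_le _ _ _
      _ = (∫⁻ x in nsec z₁ (F mm) (Δ mm), g x) + 0 := by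
          rw [setLIntegral_measure_zero _ _ (volume_image_hbox_diff z₁ (F mm) (Δ mm))]
      _ < ∞ := by rw [add_zero]; exact hfinm mm
  -- the neighbourhood
  refine ⟨Metric.ball z₁ ρ, Metric.isOpen_ball, Metric.mem_ball_self hρ, ?_⟩
  have hcover : Metric.ball z₁ ρ ⊆ {z₁} ∪ ⋃ mm, Hs mm := by
    intro x hx
    by_cases hxz : x = z₁
    · exact Or.inl hxz
    · refine Or.inr ?_
      have hx0 : x - z₁ ≠ 0 := sub_ne_zero.2 hxz
      have hxn : ‖x - z₁‖ < ρ := by rwa [Metric.mem_ball, dist_eq_norm] at hx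
      obtain ⟨mm, w, hw, hxw⟩ := hcov (x - z₁) hx0 hxn
      refine mem_iUnion.2 ⟨mm, w, hw, ?_⟩
      show z₁ + npt (F mm) w = x
      rw [← hxw]; abel
  haveI := hι
  calc ∫⁻ x in Metric.ball z₁ ρ, g x
      ≤ ∫⁻ x in {z₁} ∪ ⋃ mm, Hs mm, g x := lintegral_mono_set hcover
    _ ≤ (∫⁻ x in ({z₁} : Set (Fin (b + 1) → ℝ)), g x) + ∫⁻ x in ⋃ mm, Hs mm, g x :=
        lintegral_union_le _ _ _
    _ = 0 + ∫⁻ x in ⋃ mm, Hs mm, g x := by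
        rw [setLIntegral_measure_zero _ _ (measure_singleton z₁)]
    _ ≤ ∑' mm, ∫⁻ x in Hs mm, g x := by rw [zero_add]; exact lintegral_iUnion_le _ _
    _ = ∑ mm, ∫⁻ x in Hs mm, g x := tsum_fintype _
    _ < ∞ := ENNReal.sum_lt_top.2 fun mm _ => hfinH mm

end SepAll

/-- **Local finiteness of the density of the Taylor pieces, any base dimension** (registered part
of `stub_separateHigh_hH`; literal form of `SepAll.local_finite`): under the wall invariant, every
point of the closure of the effective base has an open neighbourhood on which the density of the
Taylor pieces against the fibre mass has finite integral. -/
theorem separateAllHH_local (k b mL m'' : ℕ) (φ : Fin m'' → (Fin (b + 1) → ℝ) × ℝ) (lo hi : Fin k → Fin k ⊕ ((Fin (b + 1) → ℚ) × ℚ)) (a : Fin k → Option ((Fin (b + 1) → ℚ) × ℚ)) (κ : Fin mL → Fin b → ℝ) (μ : Fin mL → ℝ) (e : Fin mL → ℕ) (n : ℕ) (l : Fin b → ℝ) (l₀ : ℝ) (N : ℕ) (q : ℕ → MvPolynomial (Fin b) ℝ) (R : (Fin (b + 1) → ℝ) → ℝ) (Ri : ℕ → (Fin (b + 1) → ℝ)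 → ℝ) (hR : ∀ x, R x = (∑ i ∈ Finset.range N, MvPolynomial.eval (SepAll.pr x) (q i) * SepAll.lam l l₀ x ^ i) / SepAll.common κ μ e n l l₀ x) (hRi : ∀ i, i < N → ∀ x, Ri i x = MvPolynomial.eval (SepAll.pr x) (q i) * SepAll.lam l l₀ x ^ i / SepAll.common κ μ e n l l₀ x) (hfinY : MeasureTheory.lintegral (MeasureTheory.volume.restrict {x | ∀ j, 0 < SepAll.rav x (φ j)}) (fun x => ENNReal.ofReal |R x| * SepTwo.lmass lo hi a (SepTwo.av x)) < ⊤) (hκ0 : ∀ j, e j ≠ 0 → κ j = 0 → μ j ≠ 0) (hH' : ∀ j, e j ≠ 0 → ∀ x ∈ closure {x | ∀ j, 0 < SepAll.rav x (φ j)}, SepAll.lval κ μ j x = 0 → n ≠ 0 ∧ SepAll.lam l l₀ x = 0) (hnz : ∃ x₀, (∑ i ∈ Finset.range N, MvPolynomial.eval (SepAll.pr x₀) (q i) * SepAll.lam l l₀ x₀ ^ i) ≠ 0) (z₁ : Fin (b + 1) → ℝ) (hz₁ : z₁ ∈ closure {x | ∀ j, 0 < SepAll.rav x (φ j)}) : ∃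 V : Set (Fin (b + 1) → ℝ), IsOpen V ∧ z₁ ∈ V ∧ MeasureTheory.lintegral (MeasureTheory.volume.restrict V) ({x | ∀ j, 0 < SepAll.rav x (φ j)}.indicator (fun x => (∑ i ∈ Finset.range N, ENNReal.ofReal |Ri i x|) * SepTwo.lmass lo hi a (SepTwo.av x))) < ⊤ := by
  exact SepAll.local_finite φ lo hi a κ μ e n l l₀ N q R Ri hR hRi hfinY hκ0 hH' hnz z₁ hz₁

end Summit.KontsevichZagierPeriods.ArrangementNormalForm.JanusBands
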